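import Literature.NumberTheory.IwasawaTheory.Greenberg2016.ShaOneDualLevels
import Literature.NumberTheory.IwasawaTheory.Greenberg2016.RestrictedRamificationBridge
import Literature.NumberTheory.GaloisCohomology.RestrictedRamificationUnramifiedClasses
import Literature.NumberTheory.GaloisCohomology.PoitouTateRestrictedRamification
import HarnessLib

/-!
# Bridges from the tree's `Шⁿ_S` (`shaRestricted`, `G_S`-cohomology) to Greenberg's `Ш²(K, Σ, D_k)`
# (`sha2`) and to the level sets `Ш¹ᴰ_k` (`shaOneDualLevel`) (definitions with bodies + theorems)

Topic `NumberTheory/IwasawaTheory/Greenberg2016`; namespace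
`Literature.NumberTheory.IwasawaTheory.Greenberg2016`.  Two definitions WITH BODIES (`≃+`) and
theorems; no named fact, no `sorry`, no instance, no notation.  Lane «SUR-Λ» of cell `bsd-eis` (road
memo `SUR-LAMBDA-ROAD-w5g9.md` §8, brick C7b part 4), `--supports stmt-BirchSwinnertonDyer-19032`.

PURPOSE.  The restricted Poitou–Tate Ш-duality (Milne ADT I Thm. 4.10 (a); the tree's named fact
`poitouTate_shaRestricted_tateDual` and any natural refinement of it) is stated in the currency
`shaRestricted ρ S n ≤ Hⁿ(G_S, M^{N_S})` (`restrictedCohomology`, `restrictedLocalization`).  The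
consumer `exists_nonZeroDivisor_dualEndHom_eq_zero_of_LEO` ((γ) of Greenberg 2010 Prop. 3.2.1) pairs
Greenberg's `sha2 S ρ_k ≤ H²(K_Σ/K, D_k)` (continuous cohomology of `GaloisGroupUnramifiedOutside K S`)
with `shaOneDualLevel S E k ≤ H¹(Γ_K, Hom(D_k, μ_{p^k}))`.  This file identifies the two sides:

* §1 **`sha2RestrictedEquiv S τ : ↥(shaRestricted (toGaloisModule S τ) S 2) ≃+ ↥(sha2 S τ)`** — the
  restriction of the tree's `restrictedHAddEquiv S τ 2 : H²(G_S, A^{N_S}) ≃+ H²(K_Σ/K, A)`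
  (`restrictedHAddEquiv_mem_sha2_iff`, from `loc_restrictedHAddEquiv`), and its naturality under a
  `G_S`-equivariant coefficient map `u` (`sha2RestrictedEquiv_symm_Hmap`, from `Hmap_restrictedHAddEquiv`);
* §2 `restrictedInf_invariantsHom_map` — inflation `H¹(G_S, ·^{N_S}) → H¹(Γ_K, ·)` commutes with the
  maps induced by ANY morphism of discrete `Γ_K`-modules (cocycle level);
* §3 **`shaOneRestrictedEquiv S E k hur : ↥(shaRestricted (E.layerDualRep k) S 1) ≃+
  ↥(shaOneDualLevel S E k)`** — inflation (`restrictedInf`, injective in degree `1`,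
  `restrictedInf_one_injective`) maps `Ш¹_S(K, Hom(D_k, μ))` onto `Ш¹ᴰ_k` (the classes of
  `H¹(Γ_K, ·)` unramified off `S` are exactly the inflated ones,
  `mem_range_restrictedInf_iff_forall_localization_mem_unramifiedSubgroup`; `hur` = the dual layer is
  unramified outside `S`), and its naturality under any morphism of layers
  (`shaOneRestrictedEquiv_symm_cohomologyMap`).

HONESTY: transport lemmas; no duality and nothing about BSD is proved here.  AI formalisation,
weaker than expert review; the statements are established only by the kernel check.

## References
* R. Greenberg, *Surjectivity of the global-to-local map defining a Selmer group*, Kyoto J. Math.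
  50 (2010) 853–888, §2.1 p. 7, §2.2 p. 6. [Greenberg2010]
* J. S. Milne, *Arithmetic Duality Theorems*, 2nd ed. (2006), I §4 (pp. 55–57), Thm. 4.10 (a).
  [MilneADT2006]
* D. Harari, *Galois Cohomology and Class Field Theory* (2020), §17.2–17.3. [Harari2020]
-/

noncomputable section

open scoped Classical
open Function CategoryTheory NumberField IsDedekindDomain Field
open _root_.TopRep _root_.ContRepresentation _root_.ContinuousCohomology
open Literature.NumberTheory.GaloisRepresentations
open Literature.NumberTheory.GaloisRepresentations.DiscreteGaloisModule
open Literature.NumberTheory.GaloisRepresentations.DiscreteGaloisModule.TorsionLayers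
open Literature.NumberTheory.GaloisCohomology

namespace Literature.NumberTheory.IwasawaTheory.Greenberg2016

universe u

variable {K : Type} [Field K] [NumberField K] (S : Set (HeightOneSpectrum (𝓞 K)))

/-! ### §1. `Ш²_S(K, A) ≃ Ш²(K, Σ, A)` -/

section Two

variable {Λ : Type} [CommRing Λ] [TopologicalSpace Λ]
  {A : Type} [AddCommGroup A] [Module Λ A] [TopologicalSpace A] [DiscreteTopology A] [ContinuousSMul Λ A]
  (τ : ContinuousRep (GaloisGroupUnramifiedOutside K S) Λ A)
  {B : Type} [AddCommGroup B] [Module Λ B] [TopologicalSpace B] [DiscreteTopology B] [ContinuousSMul Λ B]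
  (τ' : ContinuousRep (GaloisGroupUnramifiedOutside K S) Λ B)

/-- **A class of `H²(G_S, A^{N_S})` is in `Ш²_S` iff its transport to `H²(K_Σ/K, A)` is in Greenberg's
`Ш²(K, Σ, A)`** (both: the localisations at the places of `Σ = S ∪ {v | ∞}` vanish; the comparison
commutes with localisation, `loc_restrictedHAddEquiv`). [cite: Greenberg2010, §2.2 p. 6]
[cite: Harari2020, §17.3 (p. 294)] -/
theorem restrictedHAddEquiv_mem_sha2_iff (c : restrictedCohomology (toGaloisModule S τ) S 2) :
    restrictedHAddEquiv S τ 2 c ∈ sha2 S τ ↔ c ∈ shaRestricted (toGaloisModule S τ) S 2 := by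
  rw [mem_sha2_iff, mem_shaRestricted_iff]
  constructor
  · intro h
    refine ⟨fun w => ?_, fun v hv => ?_⟩
    · have h' := h ⟨Sum.inl w, trivial⟩
      rw [loc_restrictedHAddEquiv, EmbeddingLike.map_eq_zero_iff] at h'
      exact h'
    · have h' := h ⟨Sum.inr v, hv⟩
      rw [loc_restrictedHAddEquiv, EmbeddingLike.map_eq_zero_iff] at h'
      exact h'
  · rintro ⟨hinf, hfin⟩ ⟨v, hv⟩
    rw [loc_restrictedHAddEquiv, EmbeddingLike.map_eq_zero_iff]
    rcases v with w | w
    · exact hinf w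
    · exact hfin w hv

/-- **`Ш²_S(K, A) ≃+ Ш²(K, Σ, A)`** (restriction of `restrictedHAddEquiv S τ 2`).
[cite: Greenberg2010, §2.2 p. 6] [cite: Harari2020, §17.3 (p. 294)] -/
def sha2RestrictedEquiv : ↥(shaRestricted (toGaloisModule S τ) S 2) ≃+ ↥(sha2 S τ) where
  toFun c := ⟨restrictedHAddEquiv S τ 2 c, (restrictedHAddEquiv_mem_sha2_iff S τ c).2 c.2⟩
  invFun x := ⟨(restrictedHAddEquiv S τ 2).symm x, by
    rw [← restrictedHAddEquiv_mem_sha2_iff, AddEquiv.apply_symm_apply]; exact x.2⟩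
  left_inv c := Subtype.ext ((restrictedHAddEquiv S τ 2).symm_apply_apply c)
  right_inv x := Subtype.ext ((restrictedHAddEquiv S τ 2).apply_symm_apply x)
  map_add' a b := Subtype.ext (map_add _ _ _)

/-- Unfolding `sha2RestrictedEquiv`. [cite: Greenberg2010, §2.2 p. 6] -/
@[simp] theorem coe_sha2RestrictedEquiv (c : ↥(shaRestricted (toGaloisModule S τ) S 2)) :
    (sha2RestrictedEquiv S τ c : τ.H 2) = restrictedHAddEquiv S τ 2 c := rfl

/-- Unfolding `sha2RestrictedEquiv.symm`. [cite: Greenberg2010, §2.2 p. 6] -/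
@[simp] theorem coe_sha2RestrictedEquiv_symm (x : ↥(sha2 S τ)) :
    ((sha2RestrictedEquiv S τ).symm x : restrictedCohomology (toGaloisModule S τ) S 2) =
      (restrictedHAddEquiv S τ 2).symm x := rfl

variable (u : A →L[Λ] B) (hu : ∀ (g : GaloisGroupUnramifiedOutside K S) (a : A), u (τ g a) = τ' g (u a))

omit [NumberField K] in
/-- **Naturality of `Ш²_S ≃ Ш²(K, Σ, ·)`** under a `G_S`-equivariant coefficient map `u : A → B`:
`e⁻¹ (Hmap u x) = H²(G_S, u) (e⁻¹ x)` (the tree's `Hmap_restrictedHAddEquiv`).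
[cite: Harari2020, §17.2 (p. 290)] -/
theorem restrictedHAddEquiv_symm_Hmap (x : τ.H 2) :
    (restrictedHAddEquiv S τ' 2).symm (Hmap τ τ' u hu 2 x) =
      (ContinuousCohomology.map (ContinuousMonoidHom.id (GaloisGroupUnramifiedOutside K S))
        (ContinuousRep.invariantsHom (N := ramificationSubgroup K S) (toGaloisModuleHom S τ τ' u hu))
          2).hom ((restrictedHAddEquiv S τ 2).symm x) := by
  rw [AddEquiv.symm_apply_eq]
  conv_lhs => rw [← (restrictedHAddEquiv S τ 2).apply_symm_apply x]
  exact Hmap_restrictedHAddEquiv S τ τ' u hu 2 _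

/-- `H²(G_S, u)` maps `Ш²_S(K, A)` to `Ш²_S(K, B)` as soon as `Hmap u` preserves Greenberg's `Ш²`
(transport of membership). [cite: Greenberg2010, §2.2 p. 6] -/
theorem invariantsHom_map_mem_shaRestricted (c : ↥(shaRestricted (toGaloisModule S τ) S 2))
    (h : Hmap τ τ' u hu 2 (restrictedHAddEquiv S τ 2 c) ∈ sha2 S τ') :
    (ContinuousCohomology.map (ContinuousMonoidHom.id (GaloisGroupUnramifiedOutside K S))
        (ContinuousRep.invariantsHom (N := ramificationSubgroup K S) (toGaloisModuleHom S τ τ' u hu))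
          2).hom (c : restrictedCohomology (toGaloisModule S τ) S 2) ∈
      shaRestricted (toGaloisModule S τ') S 2 := by
  rw [← restrictedHAddEquiv_mem_sha2_iff, ← Hmap_restrictedHAddEquiv]
  exact h

/-- **`e⁻¹ ⟨Hmap u x, _⟩ = ⟨H²(G_S, u) (e⁻¹ x), _⟩` on `Ш²`.** [cite: Harari2020, §17.2 (p. 290)] -/
theorem sha2RestrictedEquiv_symm_Hmap (x : ↥(sha2 S τ)) (h : Hmap τ τ' u hu 2 x.1 ∈ sha2 S τ') :
    ((sha2RestrictedEquiv S τ').symm ⟨_, h⟩ : restrictedCohomology (toGaloisModule S τ') S 2) =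
      (ContinuousCohomology.map (ContinuousMonoidHom.id (GaloisGroupUnramifiedOutside K S))
        (ContinuousRep.invariantsHom (N := ramificationSubgroup K S) (toGaloisModuleHom S τ τ' u hu))
          2).hom ((sha2RestrictedEquiv S τ).symm x : restrictedCohomology (toGaloisModule S τ) S 2) :=
  restrictedHAddEquiv_symm_Hmap S τ τ' u hu x.1

end Two

/-! ### §2. Inflation commutes with the maps induced by a morphism of `Γ_K`-modules -/

section Inf

variable {M M' : Type} [AddCommGroup M] [TopologicalSpace M] [DiscreteTopology M]
  [AddCommGroup M'] [TopologicalSpace M'] [DiscreteTopology M']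
  (σ : DiscreteGaloisModule K M) (σ' : DiscreteGaloisModule K M')

omit [NumberField K] in
/-- **`inf ∘ H¹(G_S, F^{N_S}) = H¹(Γ_K, F) ∘ inf`** in degree `1`, for any morphism `F` of discrete
`Γ_K`-modules (on cocycles both composites are `γ ↦ F (c (γ N_S))`). [cite: SerreGaloisCohomology1997, I §2.4] -/
theorem restrictedInf_invariantsHom_map (F : σ.toTopRep ⟶ σ'.toTopRep)
    (c : restrictedCohomology σ S 1) :
    σ'.restrictedInf S 1
        ((ContinuousCohomology.map (ContinuousMonoidHom.id (GaloisGroupUnramifiedOutside K S))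
          (ContinuousRep.invariantsHom (N := ramificationSubgroup K S) F) 1).hom c) =
      cohomologyMap F 1 (σ.restrictedInf S 1 c) := by
  obtain ⟨ψ, rfl⟩ := oneCocycleClass_surjective _ c
  change (ContinuousCohomology.map _ _ 1).hom ((ContinuousCohomology.map _ _ 1).hom _) =
    (ContinuousCohomology.map _ _ 1).hom ((ContinuousCohomology.map _ _ 1).hom _)
  erw [map_oneCocycleClass, map_oneCocycleClass, map_oneCocycleClass, map_oneCocycleClass]
  exact congrArg _ (Subtype.ext (ContinuousMap.ext fun _ => rfl))

end Inf

/-! ### §3. `Ш¹_S(K, Hom(D_k, μ)) ≃ Ш¹ᴰ_k` -/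

section One

variable {D : Type} [AddCommGroup D] [TopologicalSpace D] [DiscreteTopology D]
  {τ : DiscreteGaloisModule K D} {p : ℕ} (E : τ.TorsionLayers p)

/-- **An inflated class lies in `Ш¹ᴰ_k` iff it comes from `Ш¹_S`** (off `S` an inflated class is
unramified; on `Σ` the localisations agree, `restrictedLocalization = localization ∘ inf`).
[cite: Greenberg2010, §2.1 p. 7 L10–14] [cite: MilneADT2006, Ch. I §4 (p. 55)] -/
theorem restrictedInf_mem_shaOneDualLevel_iff (k : ℕ) (c : restrictedCohomology (E.layerDualRep k) S 1) :
    (E.layerDualRep k).restrictedInf S 1 c ∈ shaOneDualLevel S E k ↔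
      c ∈ shaRestricted (E.layerDualRep k) S 1 := by
  rw [mem_shaOneDualLevel_iff, mem_shaRestricted_iff]
  constructor
  · rintro ⟨hSig, -⟩
    exact ⟨fun w => hSig (Sum.inl w) trivial, fun v hv => hSig (Sum.inr v) hv⟩
  · rintro ⟨hinf, hfin⟩
    refine ⟨fun v hv => ?_, fun w hw => ?_⟩
    · rcases v with w | w
      · exact hinf w
      · exact hfin w hv
    · exact (E.layerDualRep k).localization_mem_unramifiedSubgroup_of_mem_range_restrictedInf hw
        ⟨c, rfl⟩

/-- **Every class of `Ш¹ᴰ_k` is inflated from `Ш¹_S(K, Hom(D_k, μ))`** (unramified off `S` ⟹ in the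
image of inflation, for a dual layer unramified outside `S`). [cite: MilneADT2006, Ch. I §4 Lemma 4.8] -/
theorem exists_restrictedInf_eq_of_mem_shaOneDualLevel (k : ℕ)
    (hur : GaloisRep.IsUnramifiedOutside S (E.layerDualRep k))
    (z : galoisCohomology (E.layerDualRep k) 1) (hz : z ∈ shaOneDualLevel S E k) :
    ∃ c ∈ shaRestricted (E.layerDualRep k) S 1, (E.layerDualRep k).restrictedInf S 1 c = z := by
  obtain ⟨c, rfl⟩ :=
    (E.layerDualRep k).mem_range_restrictedInf_of_forall_localization_mem_unramifiedSubgroup hur z hz.2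
  exact ⟨c, (restrictedInf_mem_shaOneDualLevel_iff S E k c).1 hz, rfl⟩

/-- **`Ш¹_S(K, Hom(D_k, μ_{p^k})) ≃+ Ш¹ᴰ_k`** by inflation (injective in degree `1`, onto by the
previous lemma). [cite: MilneADT2006, Ch. I §4 (p. 55) and Lemma 4.8] [cite: Greenberg2010, §2.1 p. 7] -/
def shaOneRestrictedEquiv (k : ℕ) (hur : GaloisRep.IsUnramifiedOutside S (E.layerDualRep k)) :
    ↥(shaRestricted (E.layerDualRep k) S 1) ≃+ ↥(shaOneDualLevel S E k) :=
  AddEquiv.ofBijective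
    ({ toFun := fun c => ⟨(E.layerDualRep k).restrictedInf S 1 c,
          (restrictedInf_mem_shaOneDualLevel_iff S E k c.1).2 c.2⟩
       map_zero' := Subtype.ext (map_zero _)
       map_add' := fun a b => Subtype.ext (map_add _ _ _) } :
      ↥(shaRestricted (E.layerDualRep k) S 1) →+ ↥(shaOneDualLevel S E k))
    ⟨fun a b h => Subtype.ext ((E.layerDualRep k).restrictedInf_one_injective S
        (congrArg Subtype.val h)),
      fun z => by
        obtain ⟨c, hc, hcz⟩ := exists_restrictedInf_eq_of_mem_shaOneDualLevel S E k hur z.1 z.2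
        exact ⟨⟨c, hc⟩, Subtype.ext hcz⟩⟩

/-- Unfolding `shaOneRestrictedEquiv`. [cite: Greenberg2010, §2.1 p. 7] -/
@[simp] theorem coe_shaOneRestrictedEquiv (k : ℕ) (hur : GaloisRep.IsUnramifiedOutside S (E.layerDualRep k))
    (c : ↥(shaRestricted (E.layerDualRep k) S 1)) :
    (shaOneRestrictedEquiv S E k hur c : galoisCohomology (E.layerDualRep k) 1) =
      (E.layerDualRep k).restrictedInf S 1 c := rfl

/-- `inf (e⁻¹ z) = z`. [cite: Greenberg2010, §2.1 p. 7] -/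
theorem restrictedInf_shaOneRestrictedEquiv_symm (k : ℕ)
    (hur : GaloisRep.IsUnramifiedOutside S (E.layerDualRep k)) (z : ↥(shaOneDualLevel S E k)) :
    (E.layerDualRep k).restrictedInf S 1 ((shaOneRestrictedEquiv S E k hur).symm z).1 = z.1 :=
  congrArg Subtype.val ((shaOneRestrictedEquiv S E k hur).apply_symm_apply z)

/-- **Naturality of `Ш¹_S ≃ Ш¹ᴰ` under a morphism of layers** `F : Hom(D_m, μ) → Hom(D_k, μ)`:
`e_k⁻¹ ⟨H¹(F) z, _⟩ = ⟨H¹(G_S, F^{N_S}) (e_m⁻¹ z), _⟩` (inflation is natural and injective).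
[cite: SerreGaloisCohomology1997, I §2.4] -/
theorem shaOneRestrictedEquiv_symm_cohomologyMap {k m : ℕ}
    (hk : GaloisRep.IsUnramifiedOutside S (E.layerDualRep k))
    (hm : GaloisRep.IsUnramifiedOutside S (E.layerDualRep m))
    (F : (E.layerDualRep m).toTopRep ⟶ (E.layerDualRep k).toTopRep) (z : ↥(shaOneDualLevel S E m)) :
    (((shaOneRestrictedEquiv S E k hk).symm ⟨cohomologyMap F 1 z.1,
        cohomologyMap_mem_shaOneDualLevel S E F z.2⟩).1 : restrictedCohomology (E.layerDualRep k) S 1) =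
      (ContinuousCohomology.map (ContinuousMonoidHom.id (GaloisGroupUnramifiedOutside K S))
        (ContinuousRep.invariantsHom (N := ramificationSubgroup K S) F) 1).hom
        ((shaOneRestrictedEquiv S E m hm).symm z).1 := by
  apply (E.layerDualRep k).restrictedInf_one_injective S
  rw [restrictedInf_shaOneRestrictedEquiv_symm]
  exact ((restrictedInf_invariantsHom_map S (E.layerDualRep m) (E.layerDualRep k) F
    ((shaOneRestrictedEquiv S E m hm).symm z).1).trans (congrArg (cohomologyMap F 1 ·)
      (restrictedInf_shaOneRestrictedEquiv_symm S E m hm z))).symm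

end One

end Literature.NumberTheory.IwasawaTheory.Greenberg2016
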